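import Literature.NumberTheory.EllipticCurves.EichlerIntegralPolesProofs
import Literature.NumberTheory.EllipticCurves.WeierstrassPEichlerOrderProofs
import Literature.NumberTheory.EllipticCurves.LevelOneAnnihilatorProofs
import Literature.NumberTheory.EllipticCurves.PeriodLatticeRationalityProofs
import Literature.NumberTheory.EllipticCurves.NewformsProofs
import Literature.NumberTheory.EllipticCurves.NewformsHeckeProofs
import HarnessLib

/-!
# `℘_Λ(2πi∫f)` is a quotient of cusp forms; the period lattice of a rational weight-`2`
# cusp form has rational invariants (granted Deligne–Serre (2.7.2))

Topic `NumberTheory/EllipticCurves`; a proofs-only file (theorems only, no definitions, no named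
facts). Let `f ∈ S₂(Γ₀(N))` be nonzero, `u = 2πi∫_{i∞} f` its Eichler integral and `Λ = Λ(L)` a
lattice containing the period lattice `Λ_f`. The `Γ₀(N)`-invariant function `x = ℘_Λ(u)` is a
meromorphic function on the compact Riemann surface `X₀(N)` (Shimura 1971, Thm. 7.14 and §2.4);
as such it is a quotient of two holomorphic cusp forms of the same weight. We prove this here
**on `ℍ`**, with explicit forms (`exists_weierstrassP_eichlerIntegral_presentation`):

* `G = Δ^a ∏_{s ∈ S} (E₄³Δ(s) − E₄(s)³Δ)^{n(s)}` (`LevelOneAnnihilatorProofs.lean`), a level-one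
  cusp form of weight `k = 12(a + ∑ n(s))`, where `S` is a finite set of representatives of
  the `Γ₀(N)`-orbits of poles of `x` (`exists_finset_poles`), `n(s) = 2·ord_s(u − u(s))` is
  the order of the pole of `x` along the orbit of `s`
  (`meromorphicOrderAt_weierstrassP_eichlerIntegral`, `…_smul`), and `a` exceeds twice the
  order at `q_N = 0` of `V_{f∣r} = 2πi∫(f ∣[2] r)` for `r` in a finite set of representatives of
  `Γ₀(N)∖SL(2, ℤ)` (`exists_finset_mul_cover`);
* `F = x·G`, extended over the poles by Riemann's removable singularity theorem (the
  meromorphic normal form of `X·G`, which has non-negative order everywhere,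
  `meromorphicOrderAt_mul_nonneg_of_natCast_le`), `Γ₀(N)`-invariant of weight `k` by the
  identity theorem (`exists_invariant_extension`), holomorphic on `ℍ`, and vanishing at every
  cusp: `(F ∣[k] r)(τ) = ℘_Λ(C_r + V_{f∣r}(τ))·Δ(τ)^a·(bounded) → 0`
  (`IsCuspFunction.tendsto_weierstrassP_mul_pow_atImInfty`).

Consequently (`ratCast_g₂_g₃_periodLattice`) the hypothesis `hpres` of
`ratCast_g₂_g₃_of_presentation` (`PeriodLatticeRationalityProofs.lean`) is discharged: **for a
nonzero `f ∈ S₂(Γ₀(N))` with rational Fourier coefficients whose period lattice `Λ_f` is a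
lattice `Λ(L)`, and granted Deligne–Serre (2.7.2) in all weights
(`DeligneSerre1974_span_integralLattice1`), the invariants `g₂(L), g₃(L)` are rational** — the
complex torus `ℂ/Λ_f` is an elliptic curve over `ℚ` (a form of Shimura's construction of the
elliptic curve attached to `f`; Shimura 1971, Thm. 7.14; Knapp 1993, Thm. 11.74 and XI §11;
Cremona 1997, §2.10–2.14).

## References

* G. Shimura, *Introduction to the arithmetic theory of automorphic functions*, 1971: §2.4,
  Thm. 7.14. [ShimuraIATAF1971]
* F. Diamond, J. Shurman, *A First Course in Modular Forms*, GTM 228, 2005: §3.1–3.2.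
  [DiamondShurman2005]
* A. W. Knapp, *Elliptic Curves*, Princeton 1993: Thm. 11.74. [Knapp1993]
* J. E. Cremona, *Algorithms for modular elliptic curves*, 2nd ed., 1997: §2.10. [CremonaAlgorithms1997]
* P. Deligne, J.-P. Serre, *Formes modulaires de poids 1*, 1974: (2.7.2). [DeligneSerreASENS1974]
-/

noncomputable section

open Complex Filter Topology Set Function
open UpperHalfPlane hiding I
open scoped Real Topology Manifold MatrixGroups PeriodPair ModularForm

open ModularForm EisensteinSeries SlashInvariantForm ModularFormClass

open Literature.NumberTheory.EllipticCurves

namespace Literature.NumberTheory.EllipticCurves.ModularForms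

open CongruenceSubgroup

variable {N : ℕ} [NeZero N]

/-! ### Coset representatives -/

/-- **Finitely many right cosets**: for `Γ ≤ SL(2, ℤ)` of finite index there is a finite
`R ⊆ SL(2, ℤ)` with `SL(2, ℤ) = Γ R` (every `g` is `γr`, `γ ∈ Γ`, `r ∈ R`). [folklore] -/
theorem exists_finset_mul_cover (Γ : Subgroup SL(2, ℤ)) [Γ.FiniteIndex] :
    ∃ R : Finset SL(2, ℤ), ∀ g : SL(2, ℤ), ∃ γ ∈ Γ, ∃ r ∈ R, g = γ * r := by
  classical
  haveI : Fintype (SL(2, ℤ) ⧸ Γ) := Subgroup.fintypeQuotientOfFiniteIndex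
  refine ⟨Finset.univ.image fun q : SL(2, ℤ) ⧸ Γ ↦ (Quotient.out q)⁻¹, fun g ↦ ?_⟩
  set r : SL(2, ℤ) := Quotient.out ((g⁻¹ : SL(2, ℤ)) : SL(2, ℤ) ⧸ Γ) with hr
  have hrg : r⁻¹ * g⁻¹ ∈ Γ := by
    rw [← QuotientGroup.eq, hr, QuotientGroup.out_eq']
  refine ⟨(r⁻¹ * g⁻¹)⁻¹, inv_mem hrg, r⁻¹,
    Finset.mem_image.mpr ⟨((g⁻¹ : SL(2, ℤ)) : SL(2, ℤ) ⧸ Γ), Finset.mem_univ _, rfl⟩, ?_⟩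
  group

/-! ### The holomorphic, invariant extension of `x·G` -/

/-- **Removable singularities and invariance.** Let `Λ ⊇ Λ_f`, `f ≠ 0`, and let `G : ℍ → ℂ`
be holomorphic with `G(γτ) = (cτ + d)^K G(τ)` for all `γ ∈ SL(2, ℤ)`, such that at every pole
`w` of `X = ℘_Λ ∘ u` (i.e. `u(w) ∈ Λ`) the product `X·(G ∘ ofComplex)` has non-negative order.
Then there is a holomorphic `F : ℍ → ℂ`, invariant of weight `K` under `Γ₀(N)`, with
`F(τ) = ℘_Λ(u(τ))G(τ)` off the poles. (`F` is the meromorphic normal form of `X·G`, holomorphic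
by Riemann's theorem; the invariance `F(γτ) = (cτ + d)^K F(τ)` holds off the countable closed
pole set, where `x(γτ) = x(τ)`, hence everywhere by the identity theorem.) [folklore] -/
theorem exists_invariant_extension (f : CuspForm (Gamma0 N) 2) (hf : f ≠ 0) (L : PeriodPair)
    (hΛ : ∀ x ∈ periodLattice f, x ∈ L.lattice) (G : ℍ → ℂ) (K : ℕ)
    (hGan : AnalyticOnNhd ℂ (G ∘ ofComplex) {z : ℂ | 0 < z.im})
    (hGsmul : ∀ (γ : SL(2, ℤ)) (τ : ℍ), G (γ • τ) = denom γ τ ^ K * G τ)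
    (hkill : ∀ z : ℂ, 0 < z.im → eichlerIntegral f (ofComplex z) ∈ L.lattice →
      0 ≤ meromorphicOrderAt ((fun w : ℂ ↦ ℘[L] (eichlerIntegral f (ofComplex w))) *
        (G ∘ ofComplex)) z) :
    ∃ F : ℍ → ℂ, MDifferentiable 𝓘(ℂ) 𝓘(ℂ) F ∧
      (∀ γ : SL(2, ℤ), γ ∈ Gamma0 N → F ∣[(K : ℤ)] γ = F) ∧
      ∀ τ : ℍ, eichlerIntegral f τ ∉ L.lattice → ℘[L] (eichlerIntegral f τ) * G τ = F τ := by
  set U : ℂ → ℂ := fun w ↦ eichlerIntegral f (ofComplex w) with hU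
  set X : ℂ → ℂ := fun w ↦ ℘[L] (eichlerIntegral f (ofComplex w)) with hX
  set Gc : ℂ → ℂ := G ∘ ofComplex with hGc
  set H : Set ℂ := {z : ℂ | 0 < z.im} with hH
  -- `X·Gc` is meromorphic on the half-plane with non-negative orders
  have hXm : ∀ z ∈ H, MeromorphicAt X z := fun z hz ↦
    meromorphicAt_weierstrassP_eichlerIntegral f L hz
  have hXG : MeromorphicOn (X * Gc) H := fun z hz ↦ (hXm z hz).mul (hGan z hz).meromorphicAt
  have hXan : ∀ z ∈ H, U z ∉ L.lattice → AnalyticAt ℂ X z := fun z hz hzL ↦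
    analyticOnNhd_weierstrassP_eichlerIntegral f L z ⟨hz, hzL⟩
  have hord : ∀ z ∈ H, 0 ≤ meromorphicOrderAt (X * Gc) z := by
    intro z hz
    by_cases hzL : U z ∈ L.lattice
    · exact hkill z hz hzL
    · exact meromorphicOrderAt_mul_nonneg_of_analyticAt (hXan z hz hzL) (hGan z hz)
  -- the normal form `Fc`
  set Fc : ℂ → ℂ := toMeromorphicNFOn (X * Gc) H with hFc
  have hFan : AnalyticOnNhd ℂ Fc H := fun z hz ↦ analyticAt_toMeromorphicNFOn hXG hz (hord z hz)
  have hFeq : ∀ z ∈ H, U z ∉ L.lattice → Fc z = X z * Gc z := fun z hz hzL ↦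
    toMeromorphicNFOn_apply_of_analyticAt hXG hz ((hXan z hz hzL).mul (hGan z hz))
  -- invariance of `Fc` on the half-plane
  have hinv : ∀ γ : SL(2, ℤ), γ ∈ Gamma0 N → ∀ z ∈ H,
      Fc (moebius γ z) = ((γ 1 0 : ℤ) * z + (γ 1 1 : ℤ)) ^ K * Fc z := by
    intro γ hγ
    -- both sides are analytic on `H`
    have hA : AnalyticOnNhd ℂ (Fc ∘ moebius γ) H := fun z hz ↦
      (hFan (moebius γ z) (moebius_im_pos γ hz)).comp (analyticAt_moebius γ hz)
    have hB : AnalyticOnNhd ℂ (fun z ↦ ((γ 1 0 : ℤ) * z + (γ 1 1 : ℤ)) ^ K * Fc z) H :=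
      fun z hz ↦ (((analyticAt_const.mul analyticAt_id).add analyticAt_const).pow K).mul
        (hFan z hz)
    -- they agree off the poles
    have hagree : ∀ z ∈ H, U z ∉ L.lattice →
        (Fc ∘ moebius γ) z = ((γ 1 0 : ℤ) * z + (γ 1 1 : ℤ)) ^ K * Fc z := by
      intro z hz hzL
      have hz' : 0 < (moebius γ z).im := moebius_im_pos γ hz
      have hzL' : U (moebius γ z) ∉ L.lattice := by
        simp only [hU]
        rw [← smul_ofComplex γ hz]
        exact fun h ↦ hzL ((eichlerIntegral_gamma_smul_mem_iff f L hΛ ⟨γ, hγ⟩ (ofComplex z)).mp h)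
      rw [comp_apply, hFeq _ hz' hzL', hFeq z hz hzL]
      have hXeq : X (moebius γ z) = X z := by
        simp only [hX]
        rw [← smul_ofComplex γ hz]
        exact weierstrassP_eichlerIntegral_gamma_smul f L hΛ ⟨γ, hγ⟩ (ofComplex z)
      have hGeq : Gc (moebius γ z) = ((γ 1 0 : ℤ) * z + (γ 1 1 : ℤ)) ^ K * Gc z := by
        simp only [hGc, comp_apply]
        rw [← smul_ofComplex γ hz, hGsmul γ (ofComplex z), denom_ofComplex γ hz]
      rw [hXeq, hGeq]
      ring
    -- identity theorem
    obtain ⟨z₀, hz₀⟩ := nonempty_diff_of_countable (countable_setOf_eichlerIntegral_mem_lattice f L hf)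
    have hz₀H : z₀ ∈ H := hz₀.1
    have hz₀L : U z₀ ∉ L.lattice := fun h ↦ hz₀.2 ⟨hz₀.1, h⟩
    have hev : (Fc ∘ moebius γ) =ᶠ[𝓝 z₀] fun z ↦ ((γ 1 0 : ℤ) * z + (γ 1 1 : ℤ)) ^ K * Fc z := by
      filter_upwards [(isOpen_setOf_eichlerIntegral_notMem_lattice f L).mem_nhds ⟨hz₀H, hz₀L⟩]
        with z hz
      exact hagree z hz.1 hz.2
    have heq := hA.eqOn_of_preconnected_of_eventuallyEq hB convex_setOf_im_pos.isPreconnected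
      hz₀H hev
    intro z hz
    exact heq hz
  -- the function on `ℍ`
  refine ⟨fun τ : ℍ ↦ Fc τ, ?_, ?_, ?_⟩
  · rw [UpperHalfPlane.mdifferentiable_iff]
    refine hFan.differentiableOn.congr fun z hz ↦ ?_
    simp only [comp_apply, ofComplex_apply_of_im_pos hz, UpperHalfPlane.coe_mk]
  · intro γ hγ
    funext τ
    have hd : denom γ τ = (γ 1 0 : ℤ) * (τ : ℂ) + (γ 1 1 : ℤ) := by
      rw [← denom_ofComplex γ τ.im_pos, ofComplex_apply]
    have hd0 : denom γ τ ≠ 0 := denom_ne_zero γ τ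
    have h1 : ((γ • τ : ℍ) : ℂ) = moebius γ τ := by
      rw [← coe_smul_ofComplex γ τ.im_pos, ofComplex_apply]
    rw [ModularForm.SL_slash_apply]
    show Fc ((γ • τ : ℍ) : ℂ) * denom γ τ ^ (-(K : ℤ)) = Fc τ
    rw [h1, hinv γ hγ τ τ.im_pos, ← hd, zpow_neg, zpow_natCast, mul_comm (denom γ τ ^ K) _,
      mul_assoc, mul_inv_cancel₀ (pow_ne_zero _ hd0), mul_one]
  · intro τ hτ
    show ℘[L] (eichlerIntegral f τ) * G τ = Fc τ
    have := hFeq τ τ.im_pos (by simpa [hU, ofComplex_apply] using hτ)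
    rw [this]
    simp [hX, hGc, ofComplex_apply]

/-! ### Behaviour at the cusps -/

/-- `Δ` is a cuspidal `q_N`-series function (period `N`, from its period `1`). [folklore] -/
theorem isCuspFunction_discriminant : IsCuspFunction N ModularForm.discriminant := by
  have hper1 : Periodic (ModularForm.discriminant ∘ ofComplex) (1 : ℝ) :=
    SlashInvariantFormClass.periodic_comp_ofComplex CuspForm.discriminant one_mem_strictPeriods_SL
  have hperN : Periodic (ModularForm.discriminant ∘ ofComplex) (N : ℝ) := by
    simpa using hper1.nat_mul N
  exact ⟨by exact_mod_cast Nat.pos_of_ne_zero (NeZero.ne N), hperN, CuspForm.discriminant.holo',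
    discriminant_isZeroAtImInfty⟩

/-- **Vanishing at the cusp `r∞`.** Suppose `℘_Λ(u)·G = F` off the poles, `G ∣[k] r = G`,
`G = Δ^a·P` with `P` convergent at `i∞`, and `a ≥ 2m_r + 1` where `m_r` is the order at
`q_N = 0` of the `q`-expansion of `V_{f∣r} = 2πi∫(f ∣[2] r)`. Then `F ∣[k] r` tends to `0` at
`i∞`: high in the cusp, `(F ∣[k] r)(τ) = ℘_Λ(C_r + V_{f∣r}(τ))·Δ(τ)^a·P(τ)`
(`exists_eichlerIntegral_smul_eq`, `exists_forall_eichlerIntegral_smul_notMem`), and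
`℘_Λ(C_r + V_{f∣r})·Δ^a → 0` (`IsCuspFunction.tendsto_weierstrassP_mul_pow_atImInfty`).
[folklore] -/
theorem isZeroAtImInfty_slash_of_presentation (f : CuspForm (Gamma0 N) 2) (hf : f ≠ 0)
    (L : PeriodPair) (F G P : ℍ → ℂ) (k : ℤ) (a : ℕ) (r : SL(2, ℤ))
    (hFG : ∀ τ : ℍ, eichlerIntegral f τ ∉ L.lattice → ℘[L] (eichlerIntegral f τ) * G τ = F τ)
    (hGr : G ∣[k] r = G) (hGP : ∀ τ : ℍ, G τ = ModularForm.discriminant τ ^ a * P τ) {c : ℂ}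
    (hP : Tendsto P atImInfty (𝓝 c))
    (ha : 2 * analyticOrderNatAt (cuspFunction N (verticalIntegral (⇑f ∣[(2 : ℤ)] r))) 0 + 1 ≤ a) :
    IsZeroAtImInfty (F ∣[k] r) := by
  obtain ⟨C, hC⟩ := exists_eichlerIntegral_smul_eq f r
  obtain ⟨T, hT⟩ := exists_forall_eichlerIntegral_smul_notMem f hf L r
  have hV := isCuspFunction_verticalIntegral_slash f r
  have hV0 := verticalIntegral_slash_ne_zero f hf r
  have hlim := (hV.tendsto_weierstrassP_mul_pow_atImInfty hV0 isCuspFunction_discriminant L C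
    ha).mul hP
  rw [zero_mul] at hlim
  have hmem : {τ : ℍ | T ≤ τ.im} ∈ atImInfty := (atImInfty_mem _).mpr ⟨T, fun _ h ↦ h⟩
  refine (hlim.congr' ?_ : Tendsto (F ∣[k] r) atImInfty (𝓝 0))
  filter_upwards [hmem] with τ hτ
  have hGτ : G (r • τ) * denom r τ ^ (-k) = G τ := by
    have := congrFun hGr τ
    rwa [ModularForm.SL_slash_apply] at this
  rw [ModularForm.SL_slash_apply, ← hFG (r • τ) (hT τ hτ), hC τ]
  conv_rhs => rw [mul_assoc, hGτ, hGP τ]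
  ring

/-! ### The presentation -/

/-- **`℘_Λ(2πi∫f)` is a quotient of cusp forms.** For `f ∈ S₂(Γ₀(N))`, `f ≠ 0`, and a
lattice `Λ ⊇ Λ_f` there are a weight `k ≥ 1` and cusp forms `F, G ∈ S_k(Γ₁(N))`, `G ≠ 0`, fixed
by all diamond operators (they are lifts of forms on `Γ₀(N)`), with `℘_Λ(u(τ))·G(τ) = F(τ)`
whenever `u(τ) ∉ Λ`. (`G = Δ^a∏(E₄³Δ(s) − E₄(s)³Δ)^{n(s)}` kills the poles of `x = ℘_Λ(u)`,
which lie in finitely many `Γ₀(N)`-orbits; `F = xG` extends holomorphically and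
`Γ₀(N)`-invariantly over the poles and vanishes at all cusps.) This is the statement that the
`Γ₀(N)`-invariant meromorphic function `x` on `ℍ`, meromorphic at the cusps, is a meromorphic
function on `X₀(N)`, i.e. a quotient of two holomorphic forms of equal weight (Shimura 1971,
§2.4 and Thm. 7.14; Diamond–Shurman §3.1–3.2). [cite: ShimuraIATAF1971, §2.4] -/
theorem exists_weierstrassP_eichlerIntegral_presentation_twelve_le (f : CuspForm (Gamma0 N) 2)
    (hf : f ≠ 0) (L : PeriodPair) (hΛ : ∀ x ∈ periodLattice f, x ∈ L.lattice) :
    ∃ (k : ℤ) (F G : CuspForm (Gamma1 N) k), 12 ≤ k ∧ G ≠ 0 ∧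
      (∀ d : (ZMod N)ˣ, diamondOp N k (d : ZMod N) F = F) ∧
      (∀ d : (ZMod N)ˣ, diamondOp N k (d : ZMod N) G = G) ∧
      ∀ τ : ℍ, eichlerIntegral f τ ∉ L.lattice → ℘[L] (eichlerIntegral f τ) * G τ = F τ := by
  classical
  -- poles and cusps
  obtain ⟨S, hSP, hS⟩ := exists_finset_poles f hf L hΛ
  obtain ⟨R, hR⟩ := exists_finset_mul_cover (Gamma0 N)
  -- exponents
  set m : SL(2, ℤ) → ℕ := fun r ↦
    analyticOrderNatAt (cuspFunction N (verticalIntegral (⇑f ∣[(2 : ℤ)] r))) 0 with hm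
  set a : ℕ := 1 + ∑ r ∈ R, (2 * m r + 1) with ha
  have ha1 : 1 ≤ a := Nat.le_add_right _ _
  have haR : ∀ r ∈ R, 2 * m r + 1 ≤ a := fun r hr ↦
    (Finset.single_le_sum (f := fun r ↦ 2 * m r + 1) (fun _ _ ↦ Nat.zero_le _) hr).trans
      (Nat.le_add_left _ _)
  set n : ℍ → ℕ := fun s ↦ 2 * analyticOrderNatAt (fun w : ℂ ↦
    eichlerIntegral f (ofComplex w) - eichlerIntegral f (ofComplex (s : ℂ))) s with hn
  set K : ℕ := 12 * (a + ∑ s ∈ S, n s) with hK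
  have hK1 : (12 : ℤ) ≤ (K : ℤ) := by omega
  set Gf : ℍ → ℂ := fun τ ↦ ModularForm.discriminant τ ^ a *
    ∏ s ∈ S, (E₄ τ ^ 3 * ModularForm.discriminant s - E₄ s ^ 3 * ModularForm.discriminant τ) ^ n s
    with hGf
  -- properties of `G`
  have hGan : AnalyticOnNhd ℂ (Gf ∘ ofComplex) {z : ℂ | 0 < z.im} :=
    analyticOnNhd_levelOneAnnihilator S n a
  have hGsmul : ∀ (γ : SL(2, ℤ)) (τ : ℍ), Gf (γ • τ) = denom γ τ ^ K * Gf τ :=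
    fun γ τ ↦ levelOneAnnihilator_apply_smul S n a γ τ
  have hGslash : ∀ γ : SL(2, ℤ), Gf ∣[(K : ℤ)] γ = Gf := fun γ ↦ levelOneAnnihilator_slash S n a γ
  have hGmd : MDifferentiable 𝓘(ℂ) 𝓘(ℂ) Gf := mdifferentiable_levelOneAnnihilator S n a
  have hGzero : IsZeroAtImInfty Gf := isZeroAtImInfty_levelOneAnnihilator S n a ha1
  obtain ⟨τ₁, hτ₁⟩ := exists_levelOneAnnihilator_ne_zero S n a
  -- `G` kills the poles of `x`
  have hkill : ∀ z : ℂ, 0 < z.im → eichlerIntegral f (ofComplex z) ∈ L.lattice →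
      0 ≤ meromorphicOrderAt ((fun w : ℂ ↦ ℘[L] (eichlerIntegral f (ofComplex w))) *
        (Gf ∘ ofComplex)) z := by
    intro z hz hzL
    have hzL' : eichlerIntegral f ⟨z, hz⟩ ∈ L.lattice := by
      rwa [ofComplex_apply_of_im_pos hz] at hzL
    obtain ⟨γ, hγ, s, hs, hzs⟩ := hS ⟨z, hz⟩ hzL'
    have hzeq : z = ((γ • s : ℍ) : ℂ) := congrArg UpperHalfPlane.coe hzs
    have hsL : eichlerIntegral f (ofComplex (s : ℂ)) ∈ L.lattice := by
      rw [ofComplex_apply]; exact hSP s hs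
    have hXs := meromorphicOrderAt_weierstrassP_eichlerIntegral f hf L s.im_pos hsL
    have hXz : meromorphicOrderAt (fun w : ℂ ↦ ℘[L] (eichlerIntegral f (ofComplex w))) z =
        (((-2 : ℤ) * (analyticOrderNatAt (fun w : ℂ ↦ eichlerIntegral f (ofComplex w) -
          eichlerIntegral f (ofComplex (s : ℂ))) s : ℕ) : ℤ) : WithTop ℤ) := by
      rw [hzeq]
      exact (meromorphicOrderAt_weierstrassP_eichlerIntegral_smul f L hΛ ⟨γ, hγ⟩ s).trans hXs
    have hGord : (n s : ℕ∞) ≤ analyticOrderAt (Gf ∘ ofComplex) z := by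
      rw [hzeq]
      exact natCast_le_analyticOrderAt_levelOneAnnihilator S n a hs γ
    refine meromorphicOrderAt_mul_nonneg_of_natCast_le
      (meromorphicAt_weierstrassP_eichlerIntegral f L hz) hXz ?_ (hGan z hz) hGord
    simp only [hn]
    push_cast
    omega
  -- the holomorphic invariant extension `F` of `x·G`
  obtain ⟨Ff, hFmd, hFslash, hFG⟩ := exists_invariant_extension f hf L hΛ Gf K hGan hGsmul hkill
  -- vanishing at the cusps
  have hprodlim := tendsto_levelOneAnnihilator_prod_atImInfty S n
  have hFzero : ∀ g : SL(2, ℤ), IsZeroAtImInfty (Ff ∣[(K : ℤ)] g) := by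
    intro g
    obtain ⟨γ, hγ, r, hr, rfl⟩ := hR g
    rw [SlashAction.slash_mul, hFslash γ hγ]
    exact isZeroAtImInfty_slash_of_presentation f hf L Ff Gf _ (K : ℤ) a r hFG (hGslash r)
      (fun τ ↦ rfl) hprodlim (haR r hr)
  have hGzero' : ∀ g : SL(2, ℤ), IsZeroAtImInfty (Gf ∣[(K : ℤ)] g) := fun g ↦ by
    rw [hGslash g]; exact hGzero
  -- cusp forms on `Γ₀(N)`
  let F₀ : CuspForm (Gamma0 N) (K : ℤ) :=
    { toFun := Ff
      slash_action_eq' := fun A hA ↦ by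
        obtain ⟨γ, hγ, rfl⟩ := hA
        exact hFslash γ hγ
      holo' := hFmd
      zero_at_cusps' := fun {c} hc ↦ by
        rw [Subgroup.IsArithmetic.isCusp_iff_isCusp_SL2Z] at hc
        rw [OnePoint.isZeroAt_iff_forall_SL2Z hc]
        intro g _
        exact hFzero g }
  let G₀ : CuspForm (Gamma0 N) (K : ℤ) :=
    { toFun := Gf
      slash_action_eq' := fun A hA ↦ by
        obtain ⟨γ, -, rfl⟩ := hA
        exact hGslash γ
      holo' := hGmd
      zero_at_cusps' := fun {c} hc ↦ by
        rw [Subgroup.IsArithmetic.isCusp_iff_isCusp_SL2Z] at hc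
        rw [OnePoint.isZeroAt_iff_forall_SL2Z hc]
        intro g _
        exact hGzero' g }
  refine ⟨K, liftToGamma1 N K F₀, liftToGamma1 N K G₀, hK1, ?_,
    fun d ↦ diamondOp_liftToGamma1 N K (d : ZMod N) F₀,
    fun d ↦ diamondOp_liftToGamma1 N K (d : ZMod N) G₀, fun τ hτ ↦ ?_⟩
  · intro h0
    apply hτ₁
    have h1 : (liftToGamma1 N (K : ℤ) G₀ : ℍ → ℂ) τ₁ = 0 := by rw [h0]; rfl
    rwa [coe_liftToGamma1_holds N (K : ℤ) G₀] at h1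
  · rw [coe_liftToGamma1_holds N (K : ℤ) G₀, coe_liftToGamma1_holds N (K : ℤ) F₀]
    exact hFG τ hτ

/-- The presentation in the shape of hypothesis `hpres` of `ratCast_g₂_g₃_of_presentation`
(`PeriodLatticeRationalityProofs.lean`; weight `k ≥ 1`). [cite: ShimuraIATAF1971, §2.4] -/
theorem exists_weierstrassP_eichlerIntegral_presentation (f : CuspForm (Gamma0 N) 2) (hf : f ≠ 0)
    (L : PeriodPair) (hΛ : ∀ x ∈ periodLattice f, x ∈ L.lattice) :
    ∃ (k : ℤ) (F G : CuspForm (Gamma1 N) k), 1 ≤ k ∧ G ≠ 0 ∧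
      (∀ d : (ZMod N)ˣ, diamondOp N k (d : ZMod N) F = F) ∧
      (∀ d : (ZMod N)ˣ, diamondOp N k (d : ZMod N) G = G) ∧
      ∀ τ : ℍ, eichlerIntegral f τ ∉ L.lattice → ℘[L] (eichlerIntegral f τ) * G τ = F τ := by
  obtain ⟨k, F, G, hk, h⟩ := exists_weierstrassP_eichlerIntegral_presentation_twelve_le f hf L hΛ
  exact ⟨k, F, G, by omega, h⟩

/-! ### Rational invariants of the period lattice -/

/-- **The period lattice of a rational weight-`2` cusp form has rational invariants** (granted
Deligne–Serre (2.7.2) in weights `≥ 12`). Let `f ∈ S₂(Γ₀(N))`, `f ≠ 0`, have rational Fourier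
coefficients and let `L` be a period pair with `Λ(L) = Λ_f` (`periodLattice f`). Assume
`span_ℂ L_k = S_k(Γ₁(N))` for all `k ≥ 12` (the tree's named fact
`DeligneSerre1974_span_integralLattice1 N k`, Deligne–Serre 1974, (2.7.2); only the weight
`k = 12(a + ∑ n(s))` of the presentation is used). Then `g₂(L), g₃(L) ∈ ℚ`, i.e. `ℂ/Λ_f` is the
elliptic curve `y² = 4x³ − g₂x − g₃` over `ℚ` — the elliptic curve attached to `f` by Shimura's
construction, obtained here from the analytic modular parametrisation `τ ↦ (℘_Λ(u), ℘_Λ'(u))`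
and descent along `Aut(ℂ)` (the argument of `ratCast_g₂_g₃_of_presentation`, run with
`exists_weierstrassP_eichlerIntegral_presentation_twelve_le`).
[cite: ShimuraIATAF1971, Thm. 7.14] [cite: Knapp1993, Thm. 11.74 (d)] -/
theorem ratCast_g₂_g₃_periodLattice (f : CuspForm (Gamma0 N) 2) (hf : f ≠ 0)
    (hrat : ∀ n, ∃ q : ℚ, (q : ℂ) = cuspCoeff f n) (L : PeriodPair)
    (hL : ∀ x, x ∈ L.lattice ↔ x ∈ periodLattice f)
    (hDS : ∀ k : ℤ, 12 ≤ k → DeligneSerre1974_span_integralLattice1 N k) :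
    (∃ q : ℚ, (q : ℂ) = L.g₂) ∧ (∃ q : ℚ, (q : ℂ) = L.g₃) := by
  refine L.ratCast_g₂_g₃_of_forall_le fun σ M hM₂ hM₃ ↦ ?_
  obtain ⟨k, F, G, hk, hG0, hFd, hGd, hFG⟩ :=
    exists_weierstrassP_eichlerIntegral_presentation_twelve_le f hf L fun x hx ↦ (hL x).mpr hx
  have hspan := hDS k hk (by omega)
  obtain ⟨F', hF'c, hF'dia⟩ := exists_cuspForm_conj hspan σ F
  obtain ⟨G', hG'c, hG'dia⟩ := exists_cuspForm_conj hspan σ G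
  have hF'd : ∀ d : (ZMod N)ˣ, diamondOp N k (d : ZMod N) F' = F' := fun d ↦
    diamondOp_conj_eq_self hF'c (hF'dia d) (hFd d)
  have hG'd : ∀ d : (ZMod N)ˣ, diamondOp N k (d : ZMod N) G' = G' := fun d ↦
    diamondOp_conj_eq_self hG'c (hG'dia d) (hGd d)
  have hG'0 : G' ≠ 0 := ne_zero_of_conj hG'c hG0
  have hF'1 := isCuspFunction_one_gamma1 F'
  have hG'1 := isCuspFunction_one_gamma1 G'
  -- the transported differential identity and the equation for `h = F'/G'`
  have hode0 := odeFun_eq_zero_of_presentation f hf L F G hFG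
  have hode1 := odeFun_conj_eq_zero f hrat σ hF'c hG'c L.g₂ L.g₃ hode0
  rw [← hM₂, ← hM₃] at hode1
  set V : Set ℂ := {z : ℂ | 0 < z.im ∧ (⇑G' ∘ ofComplex) z ≠ 0} with hV
  have hVo : IsOpen V := hG'1.differentiableOn_comp_ofComplex.continuousOn.isOpen_inter_preimage
    isOpen_upperHalfPlaneSet isOpen_compl_singleton
  have hVC : V ⊆ {z : ℂ | 0 < z.im} := fun z hz ↦ hz.1
  have hcount : ({z : ℂ | 0 < z.im} \ V).Countable := by
    refine (countable_zeros_cuspForm G' hG'0).mono ?_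
    rintro z ⟨hz, hzV⟩
    exact ⟨hz, by by_contra h; exact hzV ⟨hz, h⟩⟩
  have hwan : AnalyticOnNhd ℂ (fun z : ℂ ↦ (⇑F' ∘ ofComplex) z / (⇑G' ∘ ofComplex) z) V :=
    fun z hz ↦ (hF'1.analyticAt_comp_ofComplex hz.1).div (hG'1.analyticAt_comp_ofComplex hz.1) hz.2
  have hvan : AnalyticOnNhd ℂ (fun z : ℂ ↦ eichlerIntegral f (ofComplex z)) V :=
    fun z hz ↦ analyticAt_eichlerIntegral_comp_ofComplex f hz.1
  have hode : ∀ z ∈ V, deriv (fun w : ℂ ↦ (⇑F' ∘ ofComplex) w / (⇑G' ∘ ofComplex) w) z ^ 2 =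
      deriv (fun w : ℂ ↦ eichlerIntegral f (ofComplex w)) z ^ 2 *
        (4 * ((⇑F' ∘ ofComplex) z / (⇑G' ∘ ofComplex) z) ^ 3 -
          M.g₂ * ((⇑F' ∘ ofComplex) z / (⇑G' ∘ ofComplex) z) - M.g₃) :=
    fun z hz ↦ deriv_div_sq_of_odeFun_eq_zero f F' G' M.g₂ M.g₃ hode1 hz.1 hz.2
  obtain ⟨z₀, hz₀im, hz₀G, h0⟩ := exists_nondegenerate_of_conj f hf L σ hF'c hG'c hG0 hFG M.g₂ M.g₃
  -- the uniqueness theorem for the Weierstrass equation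
  obtain ⟨ε, hε, c, -, hglob⟩ := M.exists_eq_weierstrassP_of_deriv_sq convex_setOf_im_pos
    isOpen_upperHalfPlaneSet hVo hVC hcount hwan hvan hode ⟨hz₀im, hz₀G⟩ h0
  -- every period lies in `M`
  have hper : ∀ γ : Gamma0 N, cuspSymbol f γ ∈ M.lattice :=
    cuspSymbol_mem_of_eq_weierstrassP f hf M F' G' hF'd hG'd hG'0 hε
      (fun z hz hGz hc ↦ hglob z ⟨hz, hGz⟩ hc)
  have hsub : periodLattice f ≤ M.lattice.toAddSubgroup := by
    rw [periodLattice, AddSubgroup.closure_le]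
    rintro _ ⟨γ, rfl⟩
    exact hper γ
  intro x hx
  exact hsub ((hL x).mp hx)

/-- **Newform version, in the shape of the Eichler–Shimura kernel.** For a newform
`f ∈ S₂(Γ₀(N))` with coefficient field `ℚ` and a period pair `L` spanning `Λ_f`, and granted
Deligne–Serre (2.7.2) in weights `≥ 12`, there are `a₄, a₆ ∈ ℚ` with `g₂(L) = −4a₄`,
`g₃(L) = −4a₆`: the torus `ℂ/Λ_f` is the elliptic curve `y² = x³ + a₄x + a₆` over `ℚ` with
Néron-type lattice `Λ_f`. This is the rationality half of the curve-free kernel `H` of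
`EichlerShimuraConstructionKernelProofs.lean` (`eichlerShimuraConstruction_of_rational_invariants`,
`exists_maninConstant_ne_zero_of_rational_invariants`); the other half of `H` — `a_p` of this
curve equals `a_p(f)` for `p ∤ N`, the Eichler–Shimura congruence relation (Knapp 1993,
Thm. 11.74 (e)) — is not addressed here. [cite: Knapp1993, Thm. 11.74 (d)]
[cite: CremonaAlgorithms1997, §2.14] -/
theorem IsNewform0.exists_rat_g₂_g₃_periodLattice {f : CuspForm (Gamma0 N) 2} (hf : IsNewform0 f)
    (hQ : coeffField f = ⊥) (L : PeriodPair) (hL : L.lattice.toAddSubgroup = periodLattice f)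
    (hDS : ∀ k : ℤ, 12 ≤ k → DeligneSerre1974_span_integralLattice1 N k) :
    ∃ a₄ a₆ : ℚ, L.g₂ = -4 * (a₄ : ℂ) ∧ L.g₃ = -4 * (a₆ : ℂ) := by
  have hL' : ∀ x, x ∈ L.lattice ↔ x ∈ periodLattice f := fun x ↦ by
    rw [← hL]
    rfl
  obtain ⟨⟨q₂, h₂⟩, ⟨q₃, h₃⟩⟩ := ratCast_g₂_g₃_periodLattice f hf.ne_zero
    (fun n ↦ exists_ratCast_eq_coeff_of_coeffField_eq_bot hQ n) L hL' hDS
  refine ⟨-q₂ / 4, -q₃ / 4, ?_, ?_⟩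
  · rw [← h₂]; push_cast; ring
  · rw [← h₃]; push_cast; ring

end Literature.NumberTheory.EllipticCurves.ModularForms

end
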